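import Mathlib.Analysis.InnerProductSpace.PiL2
import Mathlib.Algebra.BigOperators.Ring.Finset
import Mathlib.Tactic.FieldSimp
import Mathlib.Tactic.Positivity
import HarnessLib

/-!
# The two-point correlation error `ε_c` of quantum-annealing / tensor-network benchmarks

Topic `Literature/Computability/QuantumComplexity` (quantum-advantage benchmark metrics; companion of
`LinearXEBSpoofing.lean` / `SampleQueryAccess.lean`).

The figure of merit used on both sides of the D-Wave "beyond-classical quantum simulation" dispute is
the *correlation error*
$$ ε_c = \sqrt{ \frac{\sum_{i>j} (c_{ij} - \tilde c_{ij})^2}{\sum_{i>j} \tilde c_{ij}^{\,2}} }, $$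
where `c_ij = ⟨σᶻᵢ σᶻⱼ⟩` are the two-point correlators produced by the method under test (quantum
annealer, MPS, PEPS, neural quantum state, belief-propagation tensor network …) and `c̃_ij` the
ground-truth values [cite: TindallEtAl2026, Eq. (2) ("We utilize the same error metric as in Ref. (20)")]
[cite: KingEtAl2025, (main text, correlation error of QPU vs MPS/PEPS/NQS)].

We vendor it as a real DEFINITION over an arbitrary finite index type `P` of scored pairs (for the
papers, `P = {(i,j) : i > j}`), together with the elementary API a certificate needs:

* `corrError_nonneg`, `corrError_self` (`ε_c(c̃, c̃) = 0`);
* `corrError_eq_norm_div` — `ε_c` is the relative Euclidean error `‖c − c̃‖₂ / ‖c̃‖₂`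
  (in `EuclideanSpace ℝ P`);
* `corrError_eq_zero_iff` — for a non-degenerate ground truth, `ε_c = 0 ↔ c = c̃`;
* `corrError_smul` — invariance under a common rescaling of test and truth;
* `abs_corrError_sub_corrError_le` — **stability**: two methods whose correlators differ by `δ` in
  relative Euclidean norm have `ε_c` values within `δ` of each other (reverse triangle inequality).
  This is the lemma behind "certified = two independent implementations agree": agreement of the
  raw correlators to relative accuracy `δ` transfers to the published metric with the same `δ`.

Design notes. `Real.sqrt` of a quotient with zero denominator is `0` (`x / 0 = 0`); the degenerate
case `Σ c̃² = 0` is therefore harmless in every lemma below and is excluded only where the statement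
would otherwise be false (`corrError_eq_zero_iff`). Nothing here is specific to spin systems; what is
deliberately NOT here: the annealing schedule, the lattice families, or any claim about which method
attains which `ε_c` (those are computations, recorded in the lane's certificates, not mathematics).

## References

* [TindallEtAl2026] J. Tindall, A. Mello, M. Fishman, M. Stoudenmire, D. Sels, *Dynamics of disordered
  quantum systems with two- and three-dimensional tensor networks*, Science 392 (2026) 868–872
  (arXiv:2503.05693v4), Eq. (2) p. 6. Read via `lit read arxiv:2503.05693`.
* [KingEtAl2025] A. D. King et al., *Beyond-classical computation in quantum simulation*, Science 388
  (2025) 199–204 (arXiv:2403.00910), correlation error `ε_c` of Fig. 2–4.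
-/

noncomputable section

open Finset

namespace Literature.Computability.QuantumComplexity

variable {P : Type*} [Fintype P]

/-- The **correlation error** of test correlators `c` against ground-truth correlators `ct` over a
finite set `P` of scored pairs: `ε_c = √( Σ_p (c_p − c̃_p)² / Σ_p c̃_p² )`
[cite: TindallEtAl2026, Eq. (2)]. For `Σ c̃² = 0` the value is `0` by the `x / 0 = 0` convention. -/
def corrError (c ct : P → ℝ) : ℝ :=
  Real.sqrt ((∑ p, (c p - ct p) ^ 2) / ∑ p, (ct p) ^ 2)

/-- Unfolding lemma. [cite: TindallEtAl2026, Eq. (2)] -/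
theorem corrError_def (c ct : P → ℝ) :
    corrError c ct = Real.sqrt ((∑ p, (c p - ct p) ^ 2) / ∑ p, (ct p) ^ 2) := rfl

/-- `ε_c ≥ 0`. [folklore] -/
theorem corrError_nonneg (c ct : P → ℝ) : 0 ≤ corrError c ct := Real.sqrt_nonneg _

/-- The ground truth has correlation error `0` against itself. [folklore] -/
@[simp] theorem corrError_self (ct : P → ℝ) : corrError ct ct = 0 := by
  simp [corrError]

/-- The Euclidean norm of a real vector, as a square root of a sum of squares. [folklore] -/
theorem norm_toLp_two_eq_sqrt_sum_sq (f : P → ℝ) :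
    ‖(WithLp.toLp 2 f : EuclideanSpace ℝ P)‖ = Real.sqrt (∑ p, (f p) ^ 2) := by
  rw [EuclideanSpace.norm_eq]
  congr 1
  refine Finset.sum_congr rfl fun p _ => ?_
  rw [PiLp.toLp_apply, Real.norm_eq_abs, sq_abs]

/-- `ε_c` is the **relative Euclidean error** `‖c − c̃‖₂ / ‖c̃‖₂` in `EuclideanSpace ℝ P`.
[cite: TindallEtAl2026, Eq. (2)] -/
theorem corrError_eq_norm_div (c ct : P → ℝ) :
    corrError c ct =
      ‖(WithLp.toLp 2 (c - ct) : EuclideanSpace ℝ P)‖ / ‖(WithLp.toLp 2 ct : EuclideanSpace ℝ P)‖ := by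
  rw [norm_toLp_two_eq_sqrt_sum_sq, norm_toLp_two_eq_sqrt_sum_sq, corrError,
    Real.sqrt_div' _ (Finset.sum_nonneg fun p _ => sq_nonneg (ct p))]
  simp [Pi.sub_apply]

/-- The square of the correlation error (no degeneracy hypothesis needed). [folklore] -/
theorem corrError_sq (c ct : P → ℝ) :
    corrError c ct ^ 2 = (∑ p, (c p - ct p) ^ 2) / ∑ p, (ct p) ^ 2 := by
  rw [corrError, Real.sq_sqrt]
  exact div_nonneg (Finset.sum_nonneg fun p _ => sq_nonneg _)
    (Finset.sum_nonneg fun p _ => sq_nonneg _)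

/-- For a non-degenerate ground truth (`Σ c̃² ≠ 0`), the correlation error vanishes exactly when the
test correlators coincide with the truth. [folklore] -/
theorem corrError_eq_zero_iff {c ct : P → ℝ} (h : ∑ p, (ct p) ^ 2 ≠ 0) :
    corrError c ct = 0 ↔ c = ct := by
  have hden : 0 < ∑ p, (ct p) ^ 2 :=
    lt_of_le_of_ne (Finset.sum_nonneg fun p _ => sq_nonneg _) (Ne.symm h)
  have hnum : 0 ≤ ∑ p, (c p - ct p) ^ 2 := Finset.sum_nonneg fun p _ => sq_nonneg _
  constructor
  · intro h0
    have h1 : (∑ p, (c p - ct p) ^ 2) / ∑ p, (ct p) ^ 2 = 0 := by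
      have := (Real.sqrt_eq_zero (div_nonneg hnum hden.le)).1 h0
      exact this
    have h2 : ∑ p, (c p - ct p) ^ 2 = 0 := by
      rcases (div_eq_zero_iff.1 h1) with h3 | h3
      · exact h3
      · exact absurd h3 h
    have h3 := (Finset.sum_eq_zero_iff_of_nonneg (fun p _ => sq_nonneg (c p - ct p))).1 h2
    funext p
    have := h3 p (Finset.mem_univ p)
    have : c p - ct p = 0 := by
      exact pow_eq_zero_iff (n := 2) (by norm_num) |>.1 this
    linarith
  · rintro rfl
    exact corrError_self _

/-- `ε_c` is invariant under a common non-zero rescaling of test and truth. [folklore] -/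
theorem corrError_smul {a : ℝ} (ha : a ≠ 0) (c ct : P → ℝ) :
    corrError (a • c) (a • ct) = corrError c ct := by
  unfold corrError
  congr 1
  have h1 : ∑ p, ((a • c) p - (a • ct) p) ^ 2 = a ^ 2 * ∑ p, (c p - ct p) ^ 2 := by
    rw [Finset.mul_sum]
    exact Finset.sum_congr rfl fun p _ => by simp [Pi.smul_apply, smul_eq_mul]; ring
  have h2 : ∑ p, ((a • ct) p) ^ 2 = a ^ 2 * ∑ p, (ct p) ^ 2 := by
    rw [Finset.mul_sum]
    exact Finset.sum_congr rfl fun p _ => by simp [Pi.smul_apply, smul_eq_mul]; ring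
  rw [h1, h2, mul_div_mul_left _ _ (pow_ne_zero 2 ha)]

/-- **Stability of `ε_c` (reverse triangle inequality).** Two sets of test correlators `c₁`, `c₂`
scored against the same ground truth `c̃` satisfy
`|ε_c(c₁, c̃) − ε_c(c₂, c̃)| ≤ √( Σ (c₁ − c₂)² / Σ c̃² ) = ‖c₁ − c₂‖₂ / ‖c̃‖₂`.
Hence if two independent implementations agree to relative Euclidean accuracy `δ`, their published
correlation errors agree to within `δ`. [folklore] -/
theorem abs_corrError_sub_corrError_le (c₁ c₂ ct : P → ℝ) :
    |corrError c₁ ct - corrError c₂ ct| ≤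
      Real.sqrt ((∑ p, (c₁ p - c₂ p) ^ 2) / ∑ p, (ct p) ^ 2) := by
  -- rewrite everything through Euclidean norms
  have key : Real.sqrt ((∑ p, (c₁ p - c₂ p) ^ 2) / ∑ p, (ct p) ^ 2) =
      ‖(WithLp.toLp 2 (c₁ - c₂) : EuclideanSpace ℝ P)‖ /
        ‖(WithLp.toLp 2 ct : EuclideanSpace ℝ P)‖ := by
    rw [norm_toLp_two_eq_sqrt_sum_sq, norm_toLp_two_eq_sqrt_sum_sq,
      Real.sqrt_div' _ (Finset.sum_nonneg fun p _ => sq_nonneg (ct p))]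
    simp [Pi.sub_apply]
  rw [key, corrError_eq_norm_div, corrError_eq_norm_div, ← sub_div, abs_div, abs_norm]
  set v₁ : EuclideanSpace ℝ P := WithLp.toLp 2 (c₁ - ct)
  set v₂ : EuclideanSpace ℝ P := WithLp.toLp 2 (c₂ - ct)
  set w : EuclideanSpace ℝ P := WithLp.toLp 2 ct
  have hv : (WithLp.toLp 2 (c₁ - c₂) : EuclideanSpace ℝ P) = v₁ - v₂ := by
    simp only [v₁, v₂, ← WithLp.toLp_sub]
    congr 1
    abel
  rw [hv]
  by_cases hw : ‖w‖ = 0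
  · simp [hw]
  · exact div_le_div_of_nonneg_right (abs_norm_sub_norm_le v₁ v₂) (norm_nonneg w)

end Literature.Computability.QuantumComplexity

end
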